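import Summits.NavierStokesRegularity.NavierStokesRegularity.Theorems.EfficiencyFloorMaximiserSetRigidityOrbitAdmissible
import Summits.NavierStokesRegularity.NavierStokesRegularity.Theorems.EfficiencyFloorRigidExitOrbitwiseEarlyDeficit
import Summits.NavierStokesRegularity.NavierStokesRegularity.Theorems.EfficiencyFloorNearMaximiserBoundedAmplificationEarlyDeficit
import HarnessLib

/-!
# Route `EfficiencyFloor`, support `RigidExit` (stmt-25513) on the `ProductionEfficiencyDecay` ladder (stmt-22866):
# THE TYPED RESIDUE OF ITEM (ii) IS EXACT — `NearMaximiserBoundedAmplification ⟺ orbitwise uniform early deficit at ν = 1`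
# (given clause (a) at `ν = 1`), hence `MaximiserSetRigidity → (RigidExit ⟺ orbitwise early deficit)`

Helper file (`--supports stmt-NavierStokesRegularity-22866`; line `efficiency_floor`). The g22 reduction
`rigidExit_of_orbitwiseEarlyDeficit` (p838906) typed item (ii) of `RigidExit` as ONE hypothesis (hED): an ORBITWISE uniform early
deficit at viscosity `1` (for each normalised maximiser `m` one triple `(η, θ, ε)` serving every slice `ε`-close to SOME point
`x ↦ l•R(m(l•R⁻¹(x − a)))` of the orbit of `m`). This file proves the CONVERSE, so that nothing was lost in that reduction:

* `orbitwiseEarlyDeficit_of_nearMaximiserBoundedAmplification` — the route decl `NearMaximiserBoundedAmplification` implies (hED):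
  by the landed `earlyDeficit_of_nearMaximiserBoundedAmplification` (landed; uniform triple for ALL normalised maximisers) and
  `OrbitInvariance.normalisedMaximiser_orbitSlice` (p839466: every orbit point of a normalised maximiser is a normalised maximiser);
* `nearMaximiserBoundedAmplification_iff_orbitwiseEarlyDeficit` — given the classification clause (a) of `MaximiserSetRigidity` at
  `ν = 1` (hypothesis `hA1` of p838906, verbatim): `NearMaximiserBoundedAmplification ↔ (hED)`;
* `rigidExit_iff_orbitwiseEarlyDeficit_of_maximiserSetRigidity` — BY NAME: under the route decl `MaximiserSetRigidity`,
  `RigidExit ↔ (hED)`.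

HONEST FRAMING: equivalences between OPEN statements about a HYPOTHETICAL blow-up; clause (a), `RigidExit`,
`NearMaximiserBoundedAmplification`, `LerayFloorGap`, `ProductionEfficiencyDecay` (stmt-22866) and Navier–Stokes regularity stay
OPEN; no summit statement is proved. [folklore]
-/

-- the problem directory repeats the summit name (`NavierStokesRegularity/NavierStokesRegularity`)
set_option linter.dupNamespace false

noncomputable section

open Set Filter MeasureTheory Topology Function
open scoped InnerProductSpace RealInnerProductSpace ENNReal NNReal
open Literature.Analysis.FluidPDE

namespace Summit.NavierStokesRegularity.NavierStokesRegularity.Theorems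

namespace NearMaximiserBoundedAmplification

open MaximiserSetRigidity.OrbitInvariance

/-- **`NearMaximiserBoundedAmplification` ⟹ orbitwise uniform early deficit at `ν = 1`** (the hypothesis `hED` of
`rigidExit_of_orbitwiseEarlyDeficit`, verbatim): the uniform triple of `earlyDeficit_of_nearMaximiserBoundedAmplification` serves
every orbit point, because orbit points of normalised maximisers are normalised maximisers (`normalisedMaximiser_orbitSlice`). [folklore] -/
theorem orbitwiseEarlyDeficit_of_nearMaximiserBoundedAmplification
    (hN : Summit.NavierStokesRegularity.NavierStokesRegularity.Theses.EfficiencyFloor.NearMaximiserBoundedAmplification) :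
      ∀ c : ℝ, (0 < c ∧ (∀ v : EuclideanSpace ℝ (Fin 3) → EuclideanSpace ℝ (Fin 3), (ContDiff ℝ (⊤ : ℕ∞) v ∧
      Literature.Analysis.FluidPDE.VectorCalculus.IsDivFree v ∧ (∫⁻ x, ‖iteratedFDeriv ℝ 0 v x‖ₑ ^ 2 < ⊤) ∧ (∫⁻ x,
      ‖iteratedFDeriv ℝ 1 v x‖ₑ ^ 2 < ⊤) ∧ (∫⁻ x, ‖iteratedFDeriv ℝ 2 v x‖ₑ ^ 2 < ⊤)) → (∫ x,
      ⟪Literature.Analysis.FluidPDE.curl v x, fderiv ℝ v x (Literature.Analysis.FluidPDE.curl v x)⟫_ℝ) ≤ c * (∫ x,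
      ‖Literature.Analysis.FluidPDE.curl v x‖ ^ 2) ^ (3 / 4 : ℝ) * (∫ x, Literature.Analysis.FluidPDE.frobeniusNormSq
      (fderiv ℝ (Literature.Analysis.FluidPDE.curl v) x)) ^ (3 / 4 : ℝ)) ∧ ∀ c' : ℝ, (∀ w : EuclideanSpace ℝ (Fin 3) →
      EuclideanSpace ℝ (Fin 3), (ContDiff ℝ (⊤ : ℕ∞) w ∧ Literature.Analysis.FluidPDE.VectorCalculus.IsDivFree w ∧ (∫⁻
      x, ‖iteratedFDeriv ℝ 0 w x‖ₑ ^ 2 < ⊤) ∧ (∫⁻ x, ‖iteratedFDeriv ℝ 1 w x‖ₑ ^ 2 < ⊤) ∧ (∫⁻ x, ‖iteratedFDeriv ℝ 2 w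
      x‖ₑ ^ 2 < ⊤)) → (∫ x, ⟪Literature.Analysis.FluidPDE.curl w x, fderiv ℝ w x (Literature.Analysis.FluidPDE.curl w
      x)⟫_ℝ) ≤ c' * (∫ x, ‖Literature.Analysis.FluidPDE.curl w x‖ ^ 2) ^ (3 / 4 : ℝ) * (∫ x,
      Literature.Analysis.FluidPDE.frobeniusNormSq (fderiv ℝ (Literature.Analysis.FluidPDE.curl w) x)) ^ (3 / 4 : ℝ))
      → c ≤ c') → ∀ m : EuclideanSpace ℝ (Fin 3) → EuclideanSpace ℝ (Fin 3), ((ContDiff ℝ (⊤ : ℕ∞) m ∧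
      Literature.Analysis.FluidPDE.VectorCalculus.IsDivFree m ∧ (∫⁻ x, ‖iteratedFDeriv ℝ 0 m x‖ₑ ^ 2 < ⊤) ∧ (∫⁻ x,
      ‖iteratedFDeriv ℝ 1 m x‖ₑ ^ 2 < ⊤) ∧ (∫⁻ x, ‖iteratedFDeriv ℝ 2 m x‖ₑ ^ 2 < ⊤)) ∧ 0 < (∫ x,
      ‖Literature.Analysis.FluidPDE.curl m x‖ ^ 2) ∧ (∫ x, ⟪Literature.Analysis.FluidPDE.curl m x, fderiv ℝ m x
      (Literature.Analysis.FluidPDE.curl m x)⟫_ℝ) = c * (∫ x, ‖Literature.Analysis.FluidPDE.curl m x‖ ^ 2) ^ (3 / 4 :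
      ℝ) * (∫ x, Literature.Analysis.FluidPDE.frobeniusNormSq (fderiv ℝ (Literature.Analysis.FluidPDE.curl m) x)) ^ (3
      / 4 : ℝ) ∧ (∫ x, Literature.Analysis.FluidPDE.frobeniusNormSq (fderiv ℝ (Literature.Analysis.FluidPDE.curl m)
      x)) = 81 * c ^ 4 / (256 * 1 ^ 4) * (∫ x, ‖Literature.Analysis.FluidPDE.curl m x‖ ^ 2) ^ 3) → ∃ η θ ε : ℝ, 0 ≤ η
      ∧ η < 1 ∧ 0 < θ ∧ 0 < ε ∧ ∀ T : ℝ, 0 < T → ∀ (u : ℝ → EuclideanSpace ℝ (Fin 3) → EuclideanSpace ℝ (Fin 3)) (p :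
      ℝ → EuclideanSpace ℝ (Fin 3) → ℝ), Literature.Analysis.FluidPDE.IsMaximalSmoothSolution 1 0 u p T →
      Literature.Analysis.FluidPDE.IsLerayHopfOn T 1 0 (u 0) u → Literature.Analysis.FluidPDE.HasRapidSpatialDecay (u
      0) → ∀ s ∈ Set.Ioo 0 T, (∃ (a : EuclideanSpace ℝ (Fin 3)) (R : EuclideanSpace ℝ (Fin 3) ≃ₗᵢ[ℝ] EuclideanSpace ℝ
      (Fin 3)) (l : ℝ), 0 < l ∧ ((∫ x, ‖Literature.Analysis.FluidPDE.curl (u s - fun y => l • R (m (l • R.symm (y -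
      a)))) x‖ ^ 2) ≤ ε ^ 2 * (∫ x, ‖Literature.Analysis.FluidPDE.curl (u s) x‖ ^ 2) ∧ (∫ x,
      Literature.Analysis.FluidPDE.frobeniusNormSq (fderiv ℝ (Literature.Analysis.FluidPDE.curl (u s - fun y => l • R
      (m (l • R.symm (y - a))))) x)) ≤ ε ^ 2 * (∫ x, Literature.Analysis.FluidPDE.frobeniusNormSq (fderiv ℝ
      (Literature.Analysis.FluidPDE.curl (u s)) x)))) → s + η * (64 * 1 ^ 3 / (27 * c ^ 4) * (∫ x,
      ‖Literature.Analysis.FluidPDE.curl (u s) x‖ ^ 2)⁻¹ ^ 2) < T ∧ (1 - η + 2 * θ) * (∫ x,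
      ‖Literature.Analysis.FluidPDE.curl (u s) x‖ ^ 2)⁻¹ ^ 2 ≤ (∫ x, ‖Literature.Analysis.FluidPDE.curl (u (s + η *
      (64 * 1 ^ 3 / (27 * c ^ 4) * (∫ x, ‖Literature.Analysis.FluidPDE.curl (u s) x‖ ^ 2)⁻¹ ^ 2))) x‖ ^ 2)⁻¹ ^ 2 := by
  intro c hsharp m hm
  obtain ⟨η, θ, ε, hη0, hη1, hθ, hε, hlaw⟩ := earlyDeficit_of_nearMaximiserBoundedAmplification hN c hsharp
  refine ⟨η, θ, ε, hη0, hη1, hθ, hε, fun T hT u p hmax hLH hdec s hs horb => ?_⟩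
  obtain ⟨a, R, l, hl, hclose⟩ := horb
  exact hlaw 1 T one_pos hT u p hmax hLH hdec s hs (fun y => l • R (m (l • R.symm (y - a))))
    (normalisedMaximiser_orbitSlice hm a R hl) hclose

/-- **Given clause (a) at `ν = 1`: `NearMaximiserBoundedAmplification ⟺ orbitwise uniform early deficit at `ν = 1`.**
(`←` is p838906's `nearMaximiserBoundedAmplification_of_orbitwiseEarlyDeficit`; `→` is the previous theorem and does not use (a).) [folklore] -/
theorem nearMaximiserBoundedAmplification_iff_orbitwiseEarlyDeficit
    (hA1 :
      ∀ c : ℝ, (0 < c ∧ (∀ v : EuclideanSpace ℝ (Fin 3) → EuclideanSpace ℝ (Fin 3), (ContDiff ℝ (⊤ : ℕ∞) v ∧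
      Literature.Analysis.FluidPDE.VectorCalculus.IsDivFree v ∧ (∫⁻ x, ‖iteratedFDeriv ℝ 0 v x‖ₑ ^ 2 < ⊤) ∧ (∫⁻ x,
      ‖iteratedFDeriv ℝ 1 v x‖ₑ ^ 2 < ⊤) ∧ (∫⁻ x, ‖iteratedFDeriv ℝ 2 v x‖ₑ ^ 2 < ⊤)) → (∫ x,
      ⟪Literature.Analysis.FluidPDE.curl v x, fderiv ℝ v x (Literature.Analysis.FluidPDE.curl v x)⟫_ℝ) ≤ c * (∫ x,
      ‖Literature.Analysis.FluidPDE.curl v x‖ ^ 2) ^ (3 / 4 : ℝ) * (∫ x, Literature.Analysis.FluidPDE.frobeniusNormSq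
      (fderiv ℝ (Literature.Analysis.FluidPDE.curl v) x)) ^ (3 / 4 : ℝ)) ∧ ∀ c' : ℝ, (∀ w : EuclideanSpace ℝ (Fin 3) →
      EuclideanSpace ℝ (Fin 3), (ContDiff ℝ (⊤ : ℕ∞) w ∧ Literature.Analysis.FluidPDE.VectorCalculus.IsDivFree w ∧ (∫⁻
      x, ‖iteratedFDeriv ℝ 0 w x‖ₑ ^ 2 < ⊤) ∧ (∫⁻ x, ‖iteratedFDeriv ℝ 1 w x‖ₑ ^ 2 < ⊤) ∧ (∫⁻ x, ‖iteratedFDeriv ℝ 2 w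
      x‖ₑ ^ 2 < ⊤)) → (∫ x, ⟪Literature.Analysis.FluidPDE.curl w x, fderiv ℝ w x (Literature.Analysis.FluidPDE.curl w
      x)⟫_ℝ) ≤ c' * (∫ x, ‖Literature.Analysis.FluidPDE.curl w x‖ ^ 2) ^ (3 / 4 : ℝ) * (∫ x,
      Literature.Analysis.FluidPDE.frobeniusNormSq (fderiv ℝ (Literature.Analysis.FluidPDE.curl w) x)) ^ (3 / 4 : ℝ))
      → c ≤ c') → ∃ (k : ℕ) (ms : Fin k → EuclideanSpace ℝ (Fin 3) → EuclideanSpace ℝ (Fin 3)), (∀ i, ((ContDiff ℝ (⊤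
      : ℕ∞) (ms i) ∧ Literature.Analysis.FluidPDE.VectorCalculus.IsDivFree (ms i) ∧ (∫⁻ x, ‖iteratedFDeriv ℝ 0 (ms i)
      x‖ₑ ^ 2 < ⊤) ∧ (∫⁻ x, ‖iteratedFDeriv ℝ 1 (ms i) x‖ₑ ^ 2 < ⊤) ∧ (∫⁻ x, ‖iteratedFDeriv ℝ 2 (ms i) x‖ₑ ^ 2 < ⊤))
      ∧ 0 < (∫ x, ‖Literature.Analysis.FluidPDE.curl (ms i) x‖ ^ 2) ∧ (∫ x, ⟪Literature.Analysis.FluidPDE.curl (ms i)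
      x, fderiv ℝ (ms i) x (Literature.Analysis.FluidPDE.curl (ms i) x)⟫_ℝ) = c * (∫ x,
      ‖Literature.Analysis.FluidPDE.curl (ms i) x‖ ^ 2) ^ (3 / 4 : ℝ) * (∫ x,
      Literature.Analysis.FluidPDE.frobeniusNormSq (fderiv ℝ (Literature.Analysis.FluidPDE.curl (ms i)) x)) ^ (3 / 4 :
      ℝ) ∧ (∫ x, Literature.Analysis.FluidPDE.frobeniusNormSq (fderiv ℝ (Literature.Analysis.FluidPDE.curl (ms i)) x))
      = 81 * c ^ 4 / (256 * 1 ^ 4) * (∫ x, ‖Literature.Analysis.FluidPDE.curl (ms i) x‖ ^ 2) ^ 3)) ∧ ∀ m :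
      EuclideanSpace ℝ (Fin 3) → EuclideanSpace ℝ (Fin 3), ((ContDiff ℝ (⊤ : ℕ∞) m ∧
      Literature.Analysis.FluidPDE.VectorCalculus.IsDivFree m ∧ (∫⁻ x, ‖iteratedFDeriv ℝ 0 m x‖ₑ ^ 2 < ⊤) ∧ (∫⁻ x,
      ‖iteratedFDeriv ℝ 1 m x‖ₑ ^ 2 < ⊤) ∧ (∫⁻ x, ‖iteratedFDeriv ℝ 2 m x‖ₑ ^ 2 < ⊤)) ∧ 0 < (∫ x,
      ‖Literature.Analysis.FluidPDE.curl m x‖ ^ 2) ∧ (∫ x, ⟪Literature.Analysis.FluidPDE.curl m x, fderiv ℝ m x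
      (Literature.Analysis.FluidPDE.curl m x)⟫_ℝ) = c * (∫ x, ‖Literature.Analysis.FluidPDE.curl m x‖ ^ 2) ^ (3 / 4 :
      ℝ) * (∫ x, Literature.Analysis.FluidPDE.frobeniusNormSq (fderiv ℝ (Literature.Analysis.FluidPDE.curl m) x)) ^ (3
      / 4 : ℝ) ∧ (∫ x, Literature.Analysis.FluidPDE.frobeniusNormSq (fderiv ℝ (Literature.Analysis.FluidPDE.curl m)
      x)) = 81 * c ^ 4 / (256 * 1 ^ 4) * (∫ x, ‖Literature.Analysis.FluidPDE.curl m x‖ ^ 2) ^ 3) → ∃ (i : Fin k) (a :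
      EuclideanSpace ℝ (Fin 3)) (R : EuclideanSpace ℝ (Fin 3) ≃ₗᵢ[ℝ] EuclideanSpace ℝ (Fin 3)) (l : ℝ), 0 < l ∧ m =
      fun x => l • R (ms i (l • R.symm (x - a)))) :
    Summit.NavierStokesRegularity.NavierStokesRegularity.Theses.EfficiencyFloor.NearMaximiserBoundedAmplification ↔
    (
      ∀ c : ℝ, (0 < c ∧ (∀ v : EuclideanSpace ℝ (Fin 3) → EuclideanSpace ℝ (Fin 3), (ContDiff ℝ (⊤ : ℕ∞) v ∧
      Literature.Analysis.FluidPDE.VectorCalculus.IsDivFree v ∧ (∫⁻ x, ‖iteratedFDeriv ℝ 0 v x‖ₑ ^ 2 < ⊤) ∧ (∫⁻ x,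
      ‖iteratedFDeriv ℝ 1 v x‖ₑ ^ 2 < ⊤) ∧ (∫⁻ x, ‖iteratedFDeriv ℝ 2 v x‖ₑ ^ 2 < ⊤)) → (∫ x,
      ⟪Literature.Analysis.FluidPDE.curl v x, fderiv ℝ v x (Literature.Analysis.FluidPDE.curl v x)⟫_ℝ) ≤ c * (∫ x,
      ‖Literature.Analysis.FluidPDE.curl v x‖ ^ 2) ^ (3 / 4 : ℝ) * (∫ x, Literature.Analysis.FluidPDE.frobeniusNormSq
      (fderiv ℝ (Literature.Analysis.FluidPDE.curl v) x)) ^ (3 / 4 : ℝ)) ∧ ∀ c' : ℝ, (∀ w : EuclideanSpace ℝ (Fin 3) →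
      EuclideanSpace ℝ (Fin 3), (ContDiff ℝ (⊤ : ℕ∞) w ∧ Literature.Analysis.FluidPDE.VectorCalculus.IsDivFree w ∧ (∫⁻
      x, ‖iteratedFDeriv ℝ 0 w x‖ₑ ^ 2 < ⊤) ∧ (∫⁻ x, ‖iteratedFDeriv ℝ 1 w x‖ₑ ^ 2 < ⊤) ∧ (∫⁻ x, ‖iteratedFDeriv ℝ 2 w
      x‖ₑ ^ 2 < ⊤)) → (∫ x, ⟪Literature.Analysis.FluidPDE.curl w x, fderiv ℝ w x (Literature.Analysis.FluidPDE.curl w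
      x)⟫_ℝ) ≤ c' * (∫ x, ‖Literature.Analysis.FluidPDE.curl w x‖ ^ 2) ^ (3 / 4 : ℝ) * (∫ x,
      Literature.Analysis.FluidPDE.frobeniusNormSq (fderiv ℝ (Literature.Analysis.FluidPDE.curl w) x)) ^ (3 / 4 : ℝ))
      → c ≤ c') → ∀ m : EuclideanSpace ℝ (Fin 3) → EuclideanSpace ℝ (Fin 3), ((ContDiff ℝ (⊤ : ℕ∞) m ∧
      Literature.Analysis.FluidPDE.VectorCalculus.IsDivFree m ∧ (∫⁻ x, ‖iteratedFDeriv ℝ 0 m x‖ₑ ^ 2 < ⊤) ∧ (∫⁻ x,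
      ‖iteratedFDeriv ℝ 1 m x‖ₑ ^ 2 < ⊤) ∧ (∫⁻ x, ‖iteratedFDeriv ℝ 2 m x‖ₑ ^ 2 < ⊤)) ∧ 0 < (∫ x,
      ‖Literature.Analysis.FluidPDE.curl m x‖ ^ 2) ∧ (∫ x, ⟪Literature.Analysis.FluidPDE.curl m x, fderiv ℝ m x
      (Literature.Analysis.FluidPDE.curl m x)⟫_ℝ) = c * (∫ x, ‖Literature.Analysis.FluidPDE.curl m x‖ ^ 2) ^ (3 / 4 :
      ℝ) * (∫ x, Literature.Analysis.FluidPDE.frobeniusNormSq (fderiv ℝ (Literature.Analysis.FluidPDE.curl m) x)) ^ (3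
      / 4 : ℝ) ∧ (∫ x, Literature.Analysis.FluidPDE.frobeniusNormSq (fderiv ℝ (Literature.Analysis.FluidPDE.curl m)
      x)) = 81 * c ^ 4 / (256 * 1 ^ 4) * (∫ x, ‖Literature.Analysis.FluidPDE.curl m x‖ ^ 2) ^ 3) → ∃ η θ ε : ℝ, 0 ≤ η
      ∧ η < 1 ∧ 0 < θ ∧ 0 < ε ∧ ∀ T : ℝ, 0 < T → ∀ (u : ℝ → EuclideanSpace ℝ (Fin 3) → EuclideanSpace ℝ (Fin 3)) (p :
      ℝ → EuclideanSpace ℝ (Fin 3) → ℝ), Literature.Analysis.FluidPDE.IsMaximalSmoothSolution 1 0 u p T →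
      Literature.Analysis.FluidPDE.IsLerayHopfOn T 1 0 (u 0) u → Literature.Analysis.FluidPDE.HasRapidSpatialDecay (u
      0) → ∀ s ∈ Set.Ioo 0 T, (∃ (a : EuclideanSpace ℝ (Fin 3)) (R : EuclideanSpace ℝ (Fin 3) ≃ₗᵢ[ℝ] EuclideanSpace ℝ
      (Fin 3)) (l : ℝ), 0 < l ∧ ((∫ x, ‖Literature.Analysis.FluidPDE.curl (u s - fun y => l • R (m (l • R.symm (y -
      a)))) x‖ ^ 2) ≤ ε ^ 2 * (∫ x, ‖Literature.Analysis.FluidPDE.curl (u s) x‖ ^ 2) ∧ (∫ x,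
      Literature.Analysis.FluidPDE.frobeniusNormSq (fderiv ℝ (Literature.Analysis.FluidPDE.curl (u s - fun y => l • R
      (m (l • R.symm (y - a))))) x)) ≤ ε ^ 2 * (∫ x, Literature.Analysis.FluidPDE.frobeniusNormSq (fderiv ℝ
      (Literature.Analysis.FluidPDE.curl (u s)) x)))) → s + η * (64 * 1 ^ 3 / (27 * c ^ 4) * (∫ x,
      ‖Literature.Analysis.FluidPDE.curl (u s) x‖ ^ 2)⁻¹ ^ 2) < T ∧ (1 - η + 2 * θ) * (∫ x,
      ‖Literature.Analysis.FluidPDE.curl (u s) x‖ ^ 2)⁻¹ ^ 2 ≤ (∫ x, ‖Literature.Analysis.FluidPDE.curl (u (s + η *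
      (64 * 1 ^ 3 / (27 * c ^ 4) * (∫ x, ‖Literature.Analysis.FluidPDE.curl (u s) x‖ ^ 2)⁻¹ ^ 2))) x‖ ^ 2)⁻¹ ^ 2) :=
  ⟨orbitwiseEarlyDeficit_of_nearMaximiserBoundedAmplification,
    nearMaximiserBoundedAmplification_of_orbitwiseEarlyDeficit hA1⟩

/-- **BY NAME: under `MaximiserSetRigidity`, `RigidExit ⟺ orbitwise uniform early deficit at `ν = 1`.** `→`: `RigidExit`
and `MaximiserSetRigidity` give `NearMaximiserBoundedAmplification`, hence (hED) by
`orbitwiseEarlyDeficit_of_nearMaximiserBoundedAmplification`; `←`: p838906's `rigidExit_of_orbitwiseEarlyDeficit` (which does not even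
need the hypothesis). Equivalence of OPEN statements. [folklore] -/
theorem rigidExit_iff_orbitwiseEarlyDeficit_of_maximiserSetRigidity
    (hM : Summit.NavierStokesRegularity.NavierStokesRegularity.Theses.EfficiencyFloor.MaximiserSetRigidity) :
    Summit.NavierStokesRegularity.NavierStokesRegularity.Theses.EfficiencyFloor.RigidExit ↔
    (
      ∀ c : ℝ, (0 < c ∧ (∀ v : EuclideanSpace ℝ (Fin 3) → EuclideanSpace ℝ (Fin 3), (ContDiff ℝ (⊤ : ℕ∞) v ∧
      Literature.Analysis.FluidPDE.VectorCalculus.IsDivFree v ∧ (∫⁻ x, ‖iteratedFDeriv ℝ 0 v x‖ₑ ^ 2 < ⊤) ∧ (∫⁻ x,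
      ‖iteratedFDeriv ℝ 1 v x‖ₑ ^ 2 < ⊤) ∧ (∫⁻ x, ‖iteratedFDeriv ℝ 2 v x‖ₑ ^ 2 < ⊤)) → (∫ x,
      ⟪Literature.Analysis.FluidPDE.curl v x, fderiv ℝ v x (Literature.Analysis.FluidPDE.curl v x)⟫_ℝ) ≤ c * (∫ x,
      ‖Literature.Analysis.FluidPDE.curl v x‖ ^ 2) ^ (3 / 4 : ℝ) * (∫ x, Literature.Analysis.FluidPDE.frobeniusNormSq
      (fderiv ℝ (Literature.Analysis.FluidPDE.curl v) x)) ^ (3 / 4 : ℝ)) ∧ ∀ c' : ℝ, (∀ w : EuclideanSpace ℝ (Fin 3) →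
      EuclideanSpace ℝ (Fin 3), (ContDiff ℝ (⊤ : ℕ∞) w ∧ Literature.Analysis.FluidPDE.VectorCalculus.IsDivFree w ∧ (∫⁻
      x, ‖iteratedFDeriv ℝ 0 w x‖ₑ ^ 2 < ⊤) ∧ (∫⁻ x, ‖iteratedFDeriv ℝ 1 w x‖ₑ ^ 2 < ⊤) ∧ (∫⁻ x, ‖iteratedFDeriv ℝ 2 w
      x‖ₑ ^ 2 < ⊤)) → (∫ x, ⟪Literature.Analysis.FluidPDE.curl w x, fderiv ℝ w x (Literature.Analysis.FluidPDE.curl w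
      x)⟫_ℝ) ≤ c' * (∫ x, ‖Literature.Analysis.FluidPDE.curl w x‖ ^ 2) ^ (3 / 4 : ℝ) * (∫ x,
      Literature.Analysis.FluidPDE.frobeniusNormSq (fderiv ℝ (Literature.Analysis.FluidPDE.curl w) x)) ^ (3 / 4 : ℝ))
      → c ≤ c') → ∀ m : EuclideanSpace ℝ (Fin 3) → EuclideanSpace ℝ (Fin 3), ((ContDiff ℝ (⊤ : ℕ∞) m ∧
      Literature.Analysis.FluidPDE.VectorCalculus.IsDivFree m ∧ (∫⁻ x, ‖iteratedFDeriv ℝ 0 m x‖ₑ ^ 2 < ⊤) ∧ (∫⁻ x,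
      ‖iteratedFDeriv ℝ 1 m x‖ₑ ^ 2 < ⊤) ∧ (∫⁻ x, ‖iteratedFDeriv ℝ 2 m x‖ₑ ^ 2 < ⊤)) ∧ 0 < (∫ x,
      ‖Literature.Analysis.FluidPDE.curl m x‖ ^ 2) ∧ (∫ x, ⟪Literature.Analysis.FluidPDE.curl m x, fderiv ℝ m x
      (Literature.Analysis.FluidPDE.curl m x)⟫_ℝ) = c * (∫ x, ‖Literature.Analysis.FluidPDE.curl m x‖ ^ 2) ^ (3 / 4 :
      ℝ) * (∫ x, Literature.Analysis.FluidPDE.frobeniusNormSq (fderiv ℝ (Literature.Analysis.FluidPDE.curl m) x)) ^ (3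
      / 4 : ℝ) ∧ (∫ x, Literature.Analysis.FluidPDE.frobeniusNormSq (fderiv ℝ (Literature.Analysis.FluidPDE.curl m)
      x)) = 81 * c ^ 4 / (256 * 1 ^ 4) * (∫ x, ‖Literature.Analysis.FluidPDE.curl m x‖ ^ 2) ^ 3) → ∃ η θ ε : ℝ, 0 ≤ η
      ∧ η < 1 ∧ 0 < θ ∧ 0 < ε ∧ ∀ T : ℝ, 0 < T → ∀ (u : ℝ → EuclideanSpace ℝ (Fin 3) → EuclideanSpace ℝ (Fin 3)) (p :
      ℝ → EuclideanSpace ℝ (Fin 3) → ℝ), Literature.Analysis.FluidPDE.IsMaximalSmoothSolution 1 0 u p T →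
      Literature.Analysis.FluidPDE.IsLerayHopfOn T 1 0 (u 0) u → Literature.Analysis.FluidPDE.HasRapidSpatialDecay (u
      0) → ∀ s ∈ Set.Ioo 0 T, (∃ (a : EuclideanSpace ℝ (Fin 3)) (R : EuclideanSpace ℝ (Fin 3) ≃ₗᵢ[ℝ] EuclideanSpace ℝ
      (Fin 3)) (l : ℝ), 0 < l ∧ ((∫ x, ‖Literature.Analysis.FluidPDE.curl (u s - fun y => l • R (m (l • R.symm (y -
      a)))) x‖ ^ 2) ≤ ε ^ 2 * (∫ x, ‖Literature.Analysis.FluidPDE.curl (u s) x‖ ^ 2) ∧ (∫ x,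
      Literature.Analysis.FluidPDE.frobeniusNormSq (fderiv ℝ (Literature.Analysis.FluidPDE.curl (u s - fun y => l • R
      (m (l • R.symm (y - a))))) x)) ≤ ε ^ 2 * (∫ x, Literature.Analysis.FluidPDE.frobeniusNormSq (fderiv ℝ
      (Literature.Analysis.FluidPDE.curl (u s)) x)))) → s + η * (64 * 1 ^ 3 / (27 * c ^ 4) * (∫ x,
      ‖Literature.Analysis.FluidPDE.curl (u s) x‖ ^ 2)⁻¹ ^ 2) < T ∧ (1 - η + 2 * θ) * (∫ x,
      ‖Literature.Analysis.FluidPDE.curl (u s) x‖ ^ 2)⁻¹ ^ 2 ≤ (∫ x, ‖Literature.Analysis.FluidPDE.curl (u (s + η *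
      (64 * 1 ^ 3 / (27 * c ^ 4) * (∫ x, ‖Literature.Analysis.FluidPDE.curl (u s) x‖ ^ 2)⁻¹ ^ 2))) x‖ ^ 2)⁻¹ ^ 2) :=
  ⟨fun hR => orbitwiseEarlyDeficit_of_nearMaximiserBoundedAmplification (hR hM),
    fun hED => rigidExit_of_orbitwiseEarlyDeficit hED⟩

end NearMaximiserBoundedAmplification

end Summit.NavierStokesRegularity.NavierStokesRegularity.Theorems

end
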